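import Summits.Ventures.CertifiedManyBodySolver.Theses.TcThermcert1
import Summits.Ventures.CertifiedManyBodySolver.Theorems.TcThermcert1VertexDefs
import Summits.Ventures.CertifiedManyBodySolver.Theorems.TcThermcert1TrialGeneratorSockets
import HarnessLib

/-!
# Disproof of `ThermalStiffnessCeilingBoxb10_le_9o71` (K2 of route-Ventures-TcThermcert1, item stmt-Ventures-26382) — findings

Standing adversary file of hub-tc-therm-crit-2 g1 (refuter, falsifier-first; Mermin–Wagner / positivity traps). K2 is the BOX transport
`K1-leaf → ∀ U ∈ [79/10, 147/10], ObsThermalStiffnessSeqCeilingAtBeta 0 U (7/8) 10 (9/71)` (packet v4, lead RULING R121): from the anchor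
leaf `1/8` at `(U, n, t′, β·t) = (8, 7/8, 0, 10)` to the leaf `9/71` at every `U/t ∈ [7.9, 14.7]` at the same `β·t = 10`.

FINDINGS (kernel-checked below unless marked «prose»):
* (a) LOAD-BEARING ANALYSIS OF THE CONSEQUENT (the antecedent K1 cannot be discharged, so every `_false_without_` lemma is stated on the
  consequent family `BoxLeaf… := ∀ U ∈ box, leaf(U)`): `0 < θ₀` is load-bearing (`boxLeaf_false_without_theta0_pos`: θ₀ = −1 makes the flux
  premise vacuous and ρs = 1 refutes); the flux premise is load-bearing (`boxLeaf_false_without_fluxPremise`); the divergence hypothesis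
  `Tendsto Ls atTop atTop` is load-bearing for a JUNK reason (`boxLeaf_false_without_tendsto`: the constant sequence `Ls ≡ 0` makes the
  `[NeZero (Ls j)]`-guarded premise vacuous) — information for typists: any re-typing of the leaf must keep divergence (or at least
  `NeZero`/`3 ≤ L` eventually); `0 < ρs` is NOT load-bearing (`boxLeaf_iff_without_rhoPos`).
* (b) THE ANTECEDENT IS DECORATIVE OFF-ANCHOR — AND WHAT EXACTLY WOULD MAKE IT BITE. `of_consequent`: the bare box leaf implies K2;
  `anchor_of_k1`: at the single box point `U = 8` the consequent follows from K1 by monotonicity in the constant (`1/8 ≤ 9/71`), so K1 is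
  consumed only there; `of_ray`: the withdrawn packet-v3 RAY statement (`∀ U ≥ 79/10`) implies the box statement — v4 is weaker, never
  stronger. The EXACT Prop-level transport is `boxLeaf_of_k1_of_fluxCostRatioBox`: K1 gives the whole box leaf as soon as the finite-volume
  flux cost `g_L(θ; U) := log Z_L(0) − log Z_L(θ)` obeys `(71/72)·g_L(θ; U) ≤ g_L(θ; 8)` at every side `L`, twist `θ` and `U ∈ [7.9, 14.7]`
  (`FluxCostRatioBox`; note `9/71 = (72/71)·(1/8)` exactly, so the packet's constant is precisely the 71/72 ratio). The U-derivative of the flux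
  cost is `∂_U g_L = β·(⟨D⟩_θ − ⟨D⟩_0)`, the twist-induced change of the TOTAL double occupancy — `O(θ²)·O(1)`, NOT extensive (correction of
  this file's v1 wording «log Z_U − log Z_8 is extensive», due to hub-tc-therm-idea-4 g2, FINDING-K2-premise-transport e4cb7574c514cf7b on
  stmt-Ventures-26382) — but its SIGN is controlled by no known inequality and 8-site thermal floats show the cluster stiffness proxy
  INCREASING in U (the wrong direction) («prose»); hence no Prop-level transport is available and K2 is provable today only as a U-box
  CERTIFICATE (plan-2's line «vertex»: frozen-dual corner certificates on a finite rational cell cover), or by certifying `FluxCostRatioBox`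
  itself — a statement about every finite torus, not easier.
* (b′) SMALL-TORUS CHECK OF `FluxCostRatioBox` AND THE TWO REPAIRED TRANSPORTS (v3; exact ED floats of hub-tc-therm-idea-4 g3,
  FINDING-K1K2-g3-curvature-exhaustion-and-fluxratio-check 1bd03d56a54f8a15 §6 on stmt-Ventures-26382, source `fluxg.cpp` aa34eb9fb5df2b34
  [floats, diagnostic only]): `L = 2` — `g_2(θ; U) ≡ 0` (the seam flux is a pure gauge on the simple-graph 2-torus; the typed ratio holds with
  EQUALITY and no K1/K2 premise with `ρs > 0` is satisfiable at `L = 2`); `L = 3` (sector (3,3)) — `R_3 := g_3/(βθ²) = 0.2254 (U = 8),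
  0.2256 (7.9), 0.2216 (10), 0.2123 (14.7)` at `θ = 0.1`: DIAMAGNETIC and antitone in `U`, the ratio HOLDS (sliver `g(7.9)/g(8) = 1.0006 ≤
  72/71`); `L = 4` (sector (7,7), eng-5 FTLM) — `R_4(8) = −0.221 ± 0.030 < 0`, PARAMAGNETIC open shell, where the UNGUARDED ratio demands
  `R_4(U) ≤ (72/71)·R_4(8)` for all `U` in the box, against the antitone trend ⇒ `FluxCostRatioBox` is PREDICTED FALSE AS TYPED (∀ L), decided by
  one FTLM point (`U = 14.7`: violated iff `R_4(14.7) > −0.224`). Kernel content added: the sign-guarded ratio `FluxCostRatioBoxPos` (R1, only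
  where `g_L(θ; U) > 0`, which is automatic wherever a K2 premise with `ρs > 0`, `θ ≠ 0` is used) and the additive-eventual domination
  `FluxCostAdditiveBoxEv` (R2, `g_L(θ;U) ≤ g_L(θ;8) + (10/568)·θ²` for `L ≥ L₀(U)`, `|θ| ≤ θ₁(U)`; uses `9/71 = 1/8 + 1/568` and a tail
  subsequence) EACH transport K1 to the whole box leaf (`k2_of_fluxCostRatioBoxPos`, `k2_of_fluxCostAdditiveBoxEv`; `FluxCostRatioBox →
  FluxCostRatioBoxPos`). VERDICT unchanged and sharpened («prose», idea-4 g2 B9 / g3 §6 costume-adjacency): in the normal state `g_L(θ;U) ≈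
  ±A_U e^{−L/ξ_T(U)}` with shell-driven signs, so (R1) is expected to FAIL at large `L` on the sliver `U ∈ [7.9, 8)` whenever `ξ_T(7.9) > ξ_T(8)`,
  and (R2) is TRUE exactly because both curvatures vanish — i.e. it is as hard as `BoxLeaf` at `U` itself. K2 ∖ K1 has no independent
  attack surface; K2 closes iff the K1 instrument closes at the box's binding vertex (line «vertex», S4).
* (c) SEAM BUDGET. The assembly seam is `(π/4)·c < 1/10`; `9/71 = 0.126760…` sits `0.45 %` below `4/(10π) = 0.127323…` and `1/568` above K1's
  `1/8` (`seam_budget_9o71`, `nine_71_sub_one_8`): no slack to re-tune.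
* (d) NATURAL STRENGTHENINGS / MUTATIONS («prose», none refutable in the kernel — a refutation of ANY ceiling needs a certified T > 0
  stiffness FLOOR for 2D lattice fermions, and none exists): dropping `U ≤ 147/10` (the v3 ray) re-imports the unfunded large-U mechanism
  (energy-class floats θ(U) = 0.300 @ 8, 0.277 @ 14.7, 0.201 @ 50, 0.1629 @ ∞ never reach 1/10); dropping `79/10 ≤ U` admits the attractive
  side `U < 0`, where an s-wave Kosterlitz–Thouless phase with `T_KT ≈ 0.1–0.15 t` [floats, attractive-Hubbard QMC] makes the ceiling `9/71`
  at `β·t = 10` physically DOUBTFUL — the lower box bound is load-bearing in substance, not only in bookkeeping; Mermin–Wagner / Koma–Tasaki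
  forbid pair LRO at T > 0, not a positive helicity modulus, so they give no trap either way.
* (e) TARGETS = line «vertex» (hub-tc-therm-plan-2, registered 07:08:29Z, skeleton 135a6fd895490092; stubs `stub_trialGeneratorHook`,
  `stub_lagr_affine`, `stub_vertexCover`): no stub is refutable in the kernel. S3 `LagrAffineAll` is TRUE as typed (every word is linear in
  `K(U, μ₀) = H₀ + U·D − μ₀·N` or in `H(U)`, no `U·μ₀` cross term; kit-proved by plan-2, 798cc13f9ea7b5b6). S1 is the general trial-generator
  hook (hubbard-thermal-p4, p610464 accepted + p611646 pending; two-line stub closure attached on K1). S4 `VertexCoverBoxB10` is structurally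
  sound («prose»): for the KMS state `ω*` at `U₁` and a cell straddling its supporting `μ*(U₁)`, affinity in `μ₀` and gauge invariance
  `ω*([N, A]) = 0` give `λ·L_d(U₁, μ₁; ω*) + (1−λ)·L_d(U₁, μ₂; ω*) ≥ ω*(W_a(U₁))` with `λμ₁ + (1−λ)μ₂ = μ*`, so corner certification is no
  harder than true-state certification up to the freezing slack, and phantom corners off the supporting set become EASIER as charged EEB
  rows are added (infeasible relaxation ⇒ unbounded dual); the content risk is PRICE (capture ≥ 50.3 % of c_true ≈ 0.256 at β·t = 10,
  measured 0–0.9 % today; lead RULING R129a makes β·t = 6, f_req ≈ 16–17 %, the lever test), not falsity.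
* (f) LINE «vertex» GUARDS (v4, §4; skeleton now v4.2 55c235d25eb4162b, registry pointer moved 10:08Z by plan-2 re-mint, lead R149 (a); S1 and
  S3 LANDED p614740 / p616377; the one open stub is S4 `stub_vertexCover : VertexCoverBoxB10`): (i) NO EMPTY CERTIFICATE — `not_coversBoxB10_empty`:
  the junk witness `S = ∅` is not a cover, because the banded supporting set is provably inhabited at every `U ≥ 0`
  (`exists_supportingMu_mem_band`), so S4 cannot close for the wrong reason; (ii) THE BINDING CORNER IS NECESSARY —
  `coversBoxB10_cell_at_sliver` / `vertexCoverBoxB10_needs_sliver_cert`: every proof of S4 exhibits a frozen datum passing `RectCert` on a cell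
  whose `U`-interval contains `79/10` (and, `coversBoxB10_cell_at_far`, one containing `147/10`) at level `9/71` — the card's «binding corner
  first» production order is forced by the statement, not a convenience. plan-2's generic sockets `Cruxes/…/VertexRungSockets.lean` v5.2
  f76a9305a8770058 read back CLEAN (consistency with V1 by `rfl`); their only junk (`VertexCoverBoxAt β q U₁ U₂` true with `S = ∅` on a
  REVERSED box) is harmless — the leaf it yields is the vacuous ∀U («prose»; probe VRSProbe.lean 38d7016ec926774a in the seat HOME).

## HANDOFF
v2 (08:3xZ): + `FluxCostRatioBox`, `boxLeaf_of_k1_of_fluxCostRatioBox`, `k2_of_fluxCostRatioBox`, `nine_71_eq_ratio`; (b) prose corrected (idea-4 g2).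
v3 (09:1xZ): + §2′ `FluxCostRatioBoxPos`, `fluxCostRatioBoxPos_of_fluxCostRatioBox`, `boxLeaf_of_k1_of_fluxCostRatioBoxPos`, `k2_of_fluxCostRatioBoxPos`,
`FluxCostAdditiveBoxEv`, `boxLeaf_of_k1_of_fluxCostAdditiveBoxEv`, `k2_of_fluxCostAdditiveBoxEv`; finding (b′) (idea-4 g3 exact L = 2, 3 check; L = 4 prediction).
v4 (11:4xZ): + imports `Theorems.TcThermcert1VertexDefs` / `…TrialGeneratorSockets`; §4 `CoversBoxB10`, `vertexCoverBoxB10_iff_covers`, `coversBoxB10_cell_at`,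
`coversBoxB10_nonempty`, `not_coversBoxB10_empty`, `coversBoxB10_cell_at_sliver`, `coversBoxB10_cell_at_far`, `vertexCoverBoxB10_needs_sliver_cert`; finding (f).
Landed under `Theorems/…/Negative/`: nothing (hypothesis bookkeeping only; not proposed). Sorried: nothing. Next regimes if data arrive:
attractive-U mirror at β·t = 10 (a certified s-wave stiffness FLOOR there would make `79/10 ≤ U` provably load-bearing); finite-L flux
curvature at L = 4 (decides the non-junk half of `…WithoutTendsto`, shared with crit-1's K1 file) and the one FTLM point `(L, U, β·t) = (4, 14.7, 10)`
that decides `FluxCostRatioBox` as typed (b′).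
-/

noncomputable section

namespace Summit.Ventures.CertifiedManyBodySolver.Cruxes.ThermalStiffnessCeilingBoxb10_le_9o71.Disproof

open Filter Topology
open Summit.Ventures.CertifiedManyBodySolver.Observables
open Summit.Ventures.CertifiedManyBodySolver.Theses

/-! ## §0 The consequent family and its mutations -/

/-- The bare box leaf (K2's consequent): the single-temperature leaf `9/71` at `β·t = 10` at every `U ∈ [79/10, 147/10]`. -/
def BoxLeaf : Prop :=
  ∀ U : ℝ, 79 / 10 ≤ U → U ≤ 147 / 10 → ObsThermalStiffnessSeqCeilingAtBeta 0 U (7 / 8) 10 (9 / 71)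

/-- The box leaf with the scale positivity `0 < θ₀` DROPPED. -/
def BoxLeafWithoutTheta0Pos : Prop :=
  ∀ U : ℝ, 79 / 10 ≤ U → U ≤ 147 / 10 → ∀ (ρs θ₀ : ℝ), 0 < ρs → ∀ Ls : ℕ → ℕ, Tendsto Ls atTop atTop →
    (∀ (j : ℕ) [NeZero (Ls j)] (θ : ℝ), |θ| ≤ θ₀ →
      10 * ρs * θ ^ 2 ≤ thermalFluxLogZ (Ls j) 0 U (1 - 7 / 8) 10 0 - thermalFluxLogZ (Ls j) 0 U (1 - 7 / 8) 10 θ) →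
    ρs ≤ (((9 / 71 : ℚ)) : ℝ)

/-- The box leaf with the finite-volume flux premise DROPPED. -/
def BoxLeafWithoutFluxPremise : Prop :=
  ∀ U : ℝ, 79 / 10 ≤ U → U ≤ 147 / 10 → ∀ (ρs θ₀ : ℝ), 0 < ρs → 0 < θ₀ → ∀ Ls : ℕ → ℕ, Tendsto Ls atTop atTop →
    ρs ≤ (((9 / 71 : ℚ)) : ℝ)

/-- The box leaf with the divergence `Tendsto Ls atTop atTop` DROPPED (every sequence of sides admitted, including `Ls ≡ 0`). -/
def BoxLeafWithoutTendsto : Prop :=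
  ∀ U : ℝ, 79 / 10 ≤ U → U ≤ 147 / 10 → ∀ (ρs θ₀ : ℝ), 0 < ρs → 0 < θ₀ → ∀ Ls : ℕ → ℕ,
    (∀ (j : ℕ) [NeZero (Ls j)] (θ : ℝ), |θ| ≤ θ₀ →
      10 * ρs * θ ^ 2 ≤ thermalFluxLogZ (Ls j) 0 U (1 - 7 / 8) 10 0 - thermalFluxLogZ (Ls j) 0 U (1 - 7 / 8) 10 θ) →
    ρs ≤ (((9 / 71 : ℚ)) : ℝ)

/-- The box leaf with the sign hypothesis `0 < ρs` DROPPED. -/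
def BoxLeafWithoutRhoPos : Prop :=
  ∀ U : ℝ, 79 / 10 ≤ U → U ≤ 147 / 10 → ∀ (ρs θ₀ : ℝ), 0 < θ₀ → ∀ Ls : ℕ → ℕ, Tendsto Ls atTop atTop →
    (∀ (j : ℕ) [NeZero (Ls j)] (θ : ℝ), |θ| ≤ θ₀ →
      10 * ρs * θ ^ 2 ≤ thermalFluxLogZ (Ls j) 0 U (1 - 7 / 8) 10 0 - thermalFluxLogZ (Ls j) 0 U (1 - 7 / 8) 10 θ) →
    ρs ≤ (((9 / 71 : ℚ)) : ℝ)

/-! ## §1 Load-bearing analysis (a) -/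

/-- `0 < θ₀` is load-bearing: with `θ₀ = -1` the flux premise is vacuous and `ρs = 1 > 9/71` refutes (at the anchor `U = 8`). -/
theorem boxLeaf_false_without_theta0_pos : ¬ BoxLeafWithoutTheta0Pos := by
  intro h
  have h1 : (1 : ℝ) ≤ (((9 / 71 : ℚ)) : ℝ) :=
    h 8 (by norm_num) (by norm_num) 1 (-1) one_pos id tendsto_id
      (fun j _ θ hθ => absurd hθ (by have := abs_nonneg θ; linarith))
  norm_num at h1

/-- The finite-volume flux premise is load-bearing: without it `ρs = 1` refutes. -/
theorem boxLeaf_false_without_fluxPremise : ¬ BoxLeafWithoutFluxPremise := by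
  intro h
  have h1 : (1 : ℝ) ≤ (((9 / 71 : ℚ)) : ℝ) := h 8 (by norm_num) (by norm_num) 1 1 one_pos one_pos id tendsto_id
  norm_num at h1

/-- The divergence hypothesis is load-bearing for a JUNK reason: the constant sequence `Ls ≡ 0` makes the `[NeZero (Ls j)]`-guarded premise
vacuous (there is no `0 × 0` torus), and `ρs = 1` refutes. -/
theorem boxLeaf_false_without_tendsto : ¬ BoxLeafWithoutTendsto := by
  intro h
  have h1 : (1 : ℝ) ≤ (((9 / 71 : ℚ)) : ℝ) :=
    h 8 (by norm_num) (by norm_num) 1 1 one_pos one_pos (fun _ => 0) (fun j inst θ _ => absurd rfl inst.out)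
  norm_num at h1

/-- `0 < ρs` is NOT load-bearing: the leaf family is equivalent to its variant without it (a non-positive `ρs` is below `9/71` anyway). -/
theorem boxLeaf_iff_without_rhoPos : BoxLeaf ↔ BoxLeafWithoutRhoPos := by
  constructor
  · intro h U hU hU' ρs θ₀ hθ₀ Ls hLs hst
    rcases le_or_gt ρs 0 with hρ | hρ
    · exact hρ.trans (by norm_num)
    · exact h U hU hU' ρs θ₀ hρ hθ₀ Ls hLs hst
  · intro h U hU hU' ρs θ₀ _hρ hθ₀ Ls hLs hst
    exact h U hU hU' ρs θ₀ hθ₀ Ls hLs hst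

/-! ## §2 The antecedent is decorative off-anchor (b) -/

/-- The bare box leaf implies K2 (the antecedent K1 is never needed except as below). -/
theorem of_consequent (h : BoxLeaf) : TcThermcert1.ThermalStiffnessCeilingBoxb10_le_9o71 :=
  fun _ => h

/-- At the single box point `U = 8` the consequent follows from K1 by monotonicity in the constant: K1 is consumed only there. -/
theorem anchor_of_k1 (h₁ : TcThermcert1.ThermalStiffnessCeilingU8b10_le_1o8) :
    ObsThermalStiffnessSeqCeilingAtBeta 0 8 (7 / 8) 10 (9 / 71) :=
  ObsThermalStiffnessSeqCeilingAtBeta.mono h₁ (by norm_num)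

/-- The withdrawn packet-v3 RAY statement implies the v4 BOX statement (v4 is weaker, never stronger). -/
theorem of_ray
    (h : TcThermcert1.ThermalStiffnessCeilingU8b10_le_1o8 →
      ∀ U : ℝ, 79 / 10 ≤ U → ObsThermalStiffnessSeqCeilingAtBeta 0 U (7 / 8) 10 (9 / 71)) :
    TcThermcert1.ThermalStiffnessCeilingBoxb10_le_9o71 :=
  fun h₁ U hU _ => h h₁ U hU

/-- K2 is exactly «K1 → BoxLeaf» (definitional read-back of the born decl). -/
theorem k2_iff : TcThermcert1.ThermalStiffnessCeilingBoxb10_le_9o71 ↔ (TcThermcert1.ThermalStiffnessCeilingU8b10_le_1o8 → BoxLeaf) :=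
  Iff.rfl

/-- The finite-volume FLUX-COST RATIO hypothesis on the box: `(71/72)·g_L(θ; U) ≤ g_L(θ; 8)` for every side `L`, twist `θ` and
`U ∈ [79/10, 147/10]`, where `g_L(θ; U) = thermalFluxLogZ L 0 U (1/8) 10 0 − thermalFluxLogZ L 0 U (1/8) 10 θ` is the canonical-sector flux
cost at `β·t = 10`. Its U-derivative is `β·(⟨D⟩_θ − ⟨D⟩_0)` (non-extensive, sign unknown; hub-tc-therm-idea-4 g2). NOT claimed true. -/
def FluxCostRatioBox : Prop :=
  ∀ (L : ℕ) [NeZero L] (U θ : ℝ), 79 / 10 ≤ U → U ≤ 147 / 10 →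
    (71 / 72 : ℝ) * (thermalFluxLogZ L 0 U (1 - 7 / 8) 10 0 - thermalFluxLogZ L 0 U (1 - 7 / 8) 10 θ) ≤
      thermalFluxLogZ L 0 8 (1 - 7 / 8) 10 0 - thermalFluxLogZ L 0 8 (1 - 7 / 8) 10 θ

/-- **Exact Prop-level transport.** K1 and the flux-cost ratio `71/72` on the box give the whole box leaf `9/71 = (72/71)·(1/8)`:
a flux premise `10·ρs·θ² ≤ g_L(θ; U)` at `U` is a K1 premise for `(71/72)·ρs` at the anchor, so `(71/72)·ρs ≤ 1/8`. This is what the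
antecedent of K2 CAN do; whether `FluxCostRatioBox` holds is open (sign of the twist-induced double-occupancy change). -/
theorem boxLeaf_of_k1_of_fluxCostRatioBox (h₁ : TcThermcert1.ThermalStiffnessCeilingU8b10_le_1o8) (hR : FluxCostRatioBox) :
    BoxLeaf := by
  intro U hU hU' ρs θ₀ hρs hθ₀ Ls hLs hst
  have key : (71 / 72 : ℝ) * ρs ≤ (((1 / 8 : ℚ)) : ℝ) :=
    h₁ ((71 / 72 : ℝ) * ρs) θ₀ (by positivity) hθ₀ Ls hLs (fun j _ θ hθ => by
      have h1 := hst j θ hθ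
      have h2 := hR (Ls j) U θ hU hU'
      nlinarith [h1, h2, sq_nonneg θ])
  have e1 : (((1 / 8 : ℚ)) : ℝ) = 1 / 8 := by norm_num
  have e2 : (((9 / 71 : ℚ)) : ℝ) = 9 / 71 := by norm_num
  rw [e1] at key
  rw [e2]
  linarith

/-- Hence K2 itself follows from the flux-cost ratio hypothesis ALONE (the antecedent K1 is then genuinely consumed on the whole box). -/
theorem k2_of_fluxCostRatioBox (hR : FluxCostRatioBox) : TcThermcert1.ThermalStiffnessCeilingBoxb10_le_9o71 :=
  fun h₁ => boxLeaf_of_k1_of_fluxCostRatioBox h₁ hR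

/-- The packet constant is exactly the `71/72` ratio of the anchor constant. -/
theorem nine_71_eq_ratio : (9 / 71 : ℚ) = (72 / 71) * (1 / 8) := by norm_num

/-! ## §2′ Repaired transports (b′): sign-guarded ratio (R1) and additive-eventual domination (R2) -/

/-- (R1) **Sign-guarded flux-cost ratio** on the box: the `71/72` ratio is only demanded where the flux cost at `U` is POSITIVE
(diamagnetic `(L, θ)`). Vacuous on paramagnetic open shells (e.g. the `4 × 4` `(7,7)` torus at `β·t = 10`, FTLM float `R_4(8) = −0.221`),
where the unguarded `FluxCostRatioBox` is predicted false as typed. Still expected to fail at large `L` on the sliver `U ∈ [7.9, 8)`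
(costume-adjacency, finding (b′)); recorded as hypothesis bookkeeping, not as a route. -/
def FluxCostRatioBoxPos : Prop :=
  ∀ (L : ℕ) [NeZero L] (U θ : ℝ), 79 / 10 ≤ U → U ≤ 147 / 10 →
    0 < thermalFluxLogZ L 0 U (1 - 7 / 8) 10 0 - thermalFluxLogZ L 0 U (1 - 7 / 8) 10 θ →
    (71 / 72 : ℝ) * (thermalFluxLogZ L 0 U (1 - 7 / 8) 10 0 - thermalFluxLogZ L 0 U (1 - 7 / 8) 10 θ) ≤
      thermalFluxLogZ L 0 8 (1 - 7 / 8) 10 0 - thermalFluxLogZ L 0 8 (1 - 7 / 8) 10 θ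

/-- (R1) is weaker than the unguarded ratio. -/
theorem fluxCostRatioBoxPos_of_fluxCostRatioBox (h : FluxCostRatioBox) : FluxCostRatioBoxPos :=
  fun L _ U θ hU hU' _ => h L U θ hU hU'

/-- K1 + (R1) ⇒ the whole box leaf: wherever a K2 flux premise `10·ρs·θ² ≤ g_L(θ; U)` with `ρs > 0`, `θ ≠ 0` is used, `g_L(θ; U) > 0`
automatically, so the sign guard costs nothing (`θ = 0` is the trivial premise `0 ≤ 0`). -/
theorem boxLeaf_of_k1_of_fluxCostRatioBoxPos (h₁ : TcThermcert1.ThermalStiffnessCeilingU8b10_le_1o8)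
    (hR : FluxCostRatioBoxPos) : BoxLeaf := by
  intro U hU hU' ρs θ₀ hρs hθ₀ Ls hLs hst
  have key : (71 / 72 : ℝ) * ρs ≤ (((1 / 8 : ℚ)) : ℝ) :=
    h₁ ((71 / 72 : ℝ) * ρs) θ₀ (by positivity) hθ₀ Ls hLs (fun j _ θ hθ => by
      have h1 := hst j θ hθ
      rcases eq_or_ne θ 0 with rfl | hθ0
      · simp
      · have hθ2 : 0 < θ ^ 2 := lt_of_le_of_ne (sq_nonneg θ) (pow_ne_zero 2 hθ0).symm
        have hpos : 0 < thermalFluxLogZ (Ls j) 0 U (1 - 7 / 8) 10 0 - thermalFluxLogZ (Ls j) 0 U (1 - 7 / 8) 10 θ :=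
          lt_of_lt_of_le (mul_pos (mul_pos (by norm_num) hρs) hθ2) h1
        have h2 := hR (Ls j) U θ hU hU' hpos
        nlinarith [h1, h2, sq_nonneg θ])
  have e1 : (((1 / 8 : ℚ)) : ℝ) = 1 / 8 := by norm_num
  have e2 : (((9 / 71 : ℚ)) : ℝ) = 9 / 71 := by norm_num
  rw [e1] at key
  rw [e2]
  linarith

/-- Hence K2 follows from (R1) alone. -/
theorem k2_of_fluxCostRatioBoxPos (hR : FluxCostRatioBoxPos) : TcThermcert1.ThermalStiffnessCeilingBoxb10_le_9o71 :=
  fun h₁ => boxLeaf_of_k1_of_fluxCostRatioBoxPos h₁ hR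

/-- (R2) **Additive-eventual flux-cost domination** on the box: for every `U` in the box, for all large sides `L ≥ L₀(U)` and small
twists `|θ| ≤ θ₁(U)`, `g_L(θ; U) ≤ g_L(θ; 8) + (10/568)·θ²` — the additive slack is exactly the packet's `9/71 − 1/8 = 1/568`
(`nine_71_sub_one_8`). Its content is `|∂_U g_L| = β·|⟨D⟩_θ − ⟨D⟩_0|` small (idea-4 g2 §2); TRUE in the normal state precisely because both
flux costs vanish as `L → ∞`, i.e. as hard as `BoxLeaf` at `U` itself (finding (b′)): hypothesis bookkeeping, not a route. -/
def FluxCostAdditiveBoxEv : Prop :=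
  ∀ U : ℝ, 79 / 10 ≤ U → U ≤ 147 / 10 → ∃ (L₀ : ℕ) (θ₁ : ℝ), 0 < θ₁ ∧
    ∀ (L : ℕ) [NeZero L] (θ : ℝ), L₀ ≤ L → |θ| ≤ θ₁ →
      thermalFluxLogZ L 0 U (1 - 7 / 8) 10 0 - thermalFluxLogZ L 0 U (1 - 7 / 8) 10 θ ≤
        thermalFluxLogZ L 0 8 (1 - 7 / 8) 10 0 - thermalFluxLogZ L 0 8 (1 - 7 / 8) 10 θ + 10 / 568 * θ ^ 2

/-- K1 + (R2) ⇒ the whole box leaf: pass to the tail subsequence `j ↦ Ls (j + j₀)` on which `L₀ ≤ Ls`, shrink the window to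
`min θ₀ θ₁`, and apply K1 to `ρs − 1/568` (nothing to do if `ρs ≤ 1/568`). -/
theorem boxLeaf_of_k1_of_fluxCostAdditiveBoxEv (h₁ : TcThermcert1.ThermalStiffnessCeilingU8b10_le_1o8)
    (hA : FluxCostAdditiveBoxEv) : BoxLeaf := by
  intro U hU hU' ρs θ₀ hρs hθ₀ Ls hLs hst
  have e1 : (((1 / 8 : ℚ)) : ℝ) = 1 / 8 := by norm_num
  have e2 : (((9 / 71 : ℚ)) : ℝ) = 9 / 71 := by norm_num
  rw [e2]
  by_cases hsmall : ρs ≤ 1 / 568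
  · linarith
  have hbig : 1 / 568 < ρs := not_le.mp hsmall
  obtain ⟨L₀, θ₁, hθ₁, hdom⟩ := hA U hU hU'
  obtain ⟨j₀, hj₀⟩ := eventually_atTop.1 (hLs.eventually (eventually_ge_atTop L₀))
  have hLs' : Tendsto (fun j => Ls (j + j₀)) atTop atTop := hLs.comp (tendsto_add_atTop_nat j₀)
  have key : ρs - 1 / 568 ≤ (((1 / 8 : ℚ)) : ℝ) :=
    h₁ (ρs - 1 / 568) (min θ₀ θ₁) (by linarith) (lt_min hθ₀ hθ₁) (fun j => Ls (j + j₀)) hLs' (fun j inst θ hθ => by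
      haveI : NeZero (Ls (j + j₀)) := inst
      have h1 := hst (j + j₀) θ (le_trans hθ (min_le_left _ _))
      have h2 := hdom (Ls (j + j₀)) θ (hj₀ (j + j₀) (Nat.le_add_left j₀ j)) (le_trans hθ (min_le_right _ _))
      nlinarith [h1, h2, sq_nonneg θ])
  rw [e1] at key
  linarith

/-- Hence K2 follows from (R2) alone. -/
theorem k2_of_fluxCostAdditiveBoxEv (hA : FluxCostAdditiveBoxEv) : TcThermcert1.ThermalStiffnessCeilingBoxb10_le_9o71 :=
  fun h₁ => boxLeaf_of_k1_of_fluxCostAdditiveBoxEv h₁ hA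

/-! ## §3 Seam budget (c) -/

/-- `9/71` is `1/568` above K1's `1/8`. -/
theorem nine_71_sub_one_8 : (9 / 71 : ℚ) - 1 / 8 = 1 / 568 := by norm_num

/-- The assembly seam `(π/4)·(9/71) < 1/10` holds with `π < 3.15`; the wall is `c < 4/(10π)`, and `9/71 < 4/(10·3.1416)` already. -/
theorem seam_budget_9o71 : Real.pi / 4 * (9 / 71) < 1 / 10 := by
  have hπ : Real.pi < 3.15 := Real.pi_lt_d2
  nlinarith

/-- … while the v3/v4 numerology leaves no room above: `(π/4)·(2/15) > 1/10` already (`π > 3`), so no constant `≥ 2/15 = 0.1333` closes the tenth. -/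
theorem no_slack_above_2o15 : (1 : ℝ) / 10 < Real.pi / 4 * (2 / 15) := by
  have hπ : 3 < Real.pi := Real.pi_gt_three
  nlinarith


/-! ## §4 Line «vertex» guards (v4): small-model facts about the registered stub `stub_vertexCover : VertexCoverBoxB10`
(skeleton `Lines/vertex.lean` v4.2 55c235d25eb4162b). (i) NO EMPTY CERTIFICATE: the junk witness `S = ∅` cannot prove S4, because the banded
supporting set is provably inhabited at every `U ≥ 0` (`exists_supportingMu_mem_band`); (ii) THE BINDING CORNER IS NECESSARY: every cover contains a
cell whose `U`-interval contains the sliver edge `U = 79/10`, i.e. SOME frozen datum must pass `RectCert` with a corner at `U₁ ≤ 79/10` at level `9/71`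
— the card's «binding corner first» production order is forced, not a convenience; likewise a cell at the far corner `U = 147/10` is necessary.
(The generic sockets' junk — `VertexCoverBoxAt β q U₁ U₂` holds with `S = ∅` on a REVERSED box `U₂ < U₁` — is harmless: the leaf it yields is the vacuous ∀U;
recorded in HOME/hub-tc-therm-crit-2/lean/VRSProbe.lean 38d7016ec926774a, not importable here.) -/

section VertexGuards

open Summit.Ventures.CertifiedManyBodySolver.Theorems.TcThermcert1
open Summit.Ventures.CertifiedManyBodySolver.Theorems.TcThermcert1.Vertex

/-- The cover clause of S4 `VertexCoverBoxB10` (first conjunct) for a given finite cell set `S`. [cite: WangEtAl2024, §III] -/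
def CoversBoxB10 (S : Finset ((ℚ × ℚ) × (ℚ × ℚ))) : Prop :=
  ∀ U μ₀ : ℝ, 79 / 10 ≤ U → U ≤ 147 / 10 → InMuBand 10 1 0 U (7 / 8) μ₀ → IsSupportingMu 10 1 0 U (7 / 8) μ₀ →
    ∃ c ∈ S, ((c.1.1 : ℚ) : ℝ) ≤ U ∧ U ≤ ((c.1.2 : ℚ) : ℝ) ∧ ((c.2.1 : ℚ) : ℝ) ≤ μ₀ ∧ μ₀ ≤ ((c.2.2 : ℚ) : ℝ)

/-- S4 is literally `∃ S, CoversBoxB10 S ∧ (every cell certified at 9/71)`. -/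
theorem vertexCoverBoxB10_iff_covers :
    VertexCoverBoxB10 ↔ ∃ S, CoversBoxB10 S ∧ ∀ c ∈ S, ∃ d : CertDatum,
      d.RectCert ((c.1.1 : ℚ) : ℝ) ((c.1.2 : ℚ) : ℝ) ((c.2.1 : ℚ) : ℝ) ((c.2.2 : ℚ) : ℝ) (9 / 71) := Iff.rfl

/-- Every cover contains a cell over any prescribed `U ∈ [79/10, 147/10]` (the banded supporting set is inhabited there). [cite: ArakiMoriya2003, Thm. 12.11] -/
theorem coversBoxB10_cell_at {S : Finset ((ℚ × ℚ) × (ℚ × ℚ))} (hS : CoversBoxB10 S) {U : ℝ} (h₁ : 79 / 10 ≤ U) (h₂ : U ≤ 147 / 10) :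
    ∃ c ∈ S, ((c.1.1 : ℚ) : ℝ) ≤ U ∧ U ≤ ((c.1.2 : ℚ) : ℝ) := by
  obtain ⟨μ₀, hb, hs⟩ := exists_supportingMu_mem_band (tp := 0) (U := U) (n := 7 / 8) (β := 10)
    (by linarith) (by norm_num) (by norm_num) (by norm_num)
  obtain ⟨c, hc, hcU, hcU', -, -⟩ := hS U μ₀ h₁ h₂ hb hs
  exact ⟨c, hc, hcU, hcU'⟩

/-- (i) Any cover is NONEMPTY. -/
theorem coversBoxB10_nonempty {S : Finset ((ℚ × ℚ) × (ℚ × ℚ))} (hS : CoversBoxB10 S) : S.Nonempty := by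
  obtain ⟨c, hc, -⟩ := coversBoxB10_cell_at hS (U := 8) (by norm_num) (by norm_num)
  exact ⟨c, hc⟩

/-- (i′) NO EMPTY CERTIFICATE: `S = ∅` is not a cover — the junk witness does not prove S4. -/
theorem not_coversBoxB10_empty : ¬ CoversBoxB10 ∅ := fun h => by
  simpa using coversBoxB10_nonempty h

/-- (ii) THE BINDING CORNER IS NECESSARY: every cover has a cell whose `U`-interval contains the sliver edge `79/10`, so some frozen datum must
pass `RectCert` with a corner at `U₁ ≤ 79/10` (level `9/71`). -/
theorem coversBoxB10_cell_at_sliver {S : Finset ((ℚ × ℚ) × (ℚ × ℚ))} (hS : CoversBoxB10 S) :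
    ∃ c ∈ S, ((c.1.1 : ℚ) : ℝ) ≤ 79 / 10 ∧ (79 / 10 : ℝ) ≤ ((c.1.2 : ℚ) : ℝ) :=
  coversBoxB10_cell_at hS (by norm_num) (by norm_num)

/-- (ii′) … and a cell at the far corner `U = 147/10` is necessary as well. -/
theorem coversBoxB10_cell_at_far {S : Finset ((ℚ × ℚ) × (ℚ × ℚ))} (hS : CoversBoxB10 S) :
    ∃ c ∈ S, ((c.1.1 : ℚ) : ℝ) ≤ 147 / 10 ∧ (147 / 10 : ℝ) ≤ ((c.1.2 : ℚ) : ℝ) :=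
  coversBoxB10_cell_at hS (by norm_num) (by norm_num)

/-- Consequently any proof of S4 exhibits a genuine `RectCert` datum on a cell touching `U = 79/10` at level `9/71` (no cover avoids the sliver). -/
theorem vertexCoverBoxB10_needs_sliver_cert (h : VertexCoverBoxB10) :
    ∃ (a b μ₁ μ₂ : ℚ) (d : CertDatum), ((a : ℚ) : ℝ) ≤ 79 / 10 ∧ (79 / 10 : ℝ) ≤ ((b : ℚ) : ℝ) ∧
      d.RectCert ((a : ℚ) : ℝ) ((b : ℚ) : ℝ) ((μ₁ : ℚ) : ℝ) ((μ₂ : ℚ) : ℝ) (9 / 71) := by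
  obtain ⟨S, hS, hcert⟩ := h
  obtain ⟨c, hc, ha, hb⟩ := coversBoxB10_cell_at_sliver hS
  obtain ⟨d, hd⟩ := hcert c hc
  exact ⟨c.1.1, c.1.2, c.2.1, c.2.2, d, ha, hb, hd⟩

end VertexGuards

end Summit.Ventures.CertifiedManyBodySolver.Cruxes.ThermalStiffnessCeilingBoxb10_le_9o71.Disproof
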